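import Summits.MatrixMultiplication.MatrixMultiplication.Theses.FidelityWitnesses
import Summits.MatrixMultiplication.MatrixMultiplication.Theorems.LinearDefectLaw.Negative.TwoByTwoRungs
import Literature.Computability.AlgebraicComplexity.AlderStrassenProofs
import Literature.Computability.AlgebraicComplexity.AsymptoticRankZariskiClosedProofs
import Literature.Computability.AlgebraicComplexity.BorderRankLimit
import Literature.Computability.AlgebraicComplexity.GroupAlgebraTensor

/-!
# Line `critical-compression-normal-form` for crux `FidelityWitnesses.LinearDefectLaw` (stmt-MatrixMultiplication-14039)

Skeleton (crux-plan, opening round 1, `planner-cruxplan-stmt-MatrixMultiplication-14039-critical-compression-0`,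
2026-08-16) of idea card `Cruxes/LinearDefectLaw/Ideas/critical-compression-normal-form.md` (crux-ideate r1,
ideator 1); triage r1-1 / r1-2 / r1-3: **pass (as entry lemma) / pass (entry-lemma component) / fail (as a
standalone line)** — every sharpening is built in (line card `Lines/critical-compression-normal-form.md`,
§ Triage answers): `TopThreeRungs` is NOT a stub, none of the self-refuted strengthenings (SpectralGap,
MeanDeficiency, ResidualRank / completion-as-a-law) is a stub, stratum (i) is CONDITIONAL on the residual, and
the open core is the unit-residual statement in the concise regime, fed with the normal form.

THE CRUX. `LinearDefectLaw : ∀ n r S, tensorRank S ≤ r → ‖Σ S·⟨n,n,n⟩‖² ≤ (n³ + r − R̲(⟨n,n,n⟩))·Σ‖S‖²`, i.e.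
`M(n,r) ≤ n³ − (R̲ − r)`, i.e. `d_r := dist(⟨n,n,n⟩, σ̂_r)² ≥ R̲(⟨n,n,n⟩) − r` (`R̲ = algBorderRank` over `ℂ`,
`σ̂_r = secantCone n r := closure {tensorRank ≤ r} = {R̲ ≤ r}` by the tree's Alder–Strassen theorem).

THE LINE (critical compressions + deficiency stratification, composition PROVED below).
* Reduction to the distance profile (proved glue `law_at_of_distLaw`): projecting `T := ⟨n,n,n⟩` onto the
  complex line through an honest rank-`≤ r` tensor `S` gives a point of `σ̂_r` at squared distance
  `n³ − |Σ S·T|²/Σ‖S‖²`, so `d_r ≥ R̲ − r` at a CLOSEST POINT of `σ̂_r` (`stub_closestPoint`, compactness) is the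
  law at level `r`.
* The distance law `R̲ − r ≤ d(S_r)` at closest points is proved by DOWNWARD INDUCTION on `R̲ − r` (proved glue
  `distLaw_aux`), each step being a three-way dichotomy at the closest point `S` of level `r`:
  (a) some rank-one direction of a factor is UNUSED by `S` (`HasUnusedDirection`) — then the uncovered
      rotated unit product is EXHIBITED (`stub_unusedDirection`, true for every tensor, the proved regime of the
      card's L2 / of URL) and one rank-one step (`stub_oneStep`, two-plane Bessel inside the closed cones) lands
      in `σ̂_{r+1}` at squared distance `≤ d − 1`, so the induction hypothesis applies;
  (b) the residual `R = T − S` is COMPLETABLE within budget, `R̲(R) ≤ ⌊d⌋` — then the primal completion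
      `T = S + R` gives `R̲(T) ≤ r + ⌊d⌋` (`stub_primalCompletion`, border subadditivity over `ℂ`), i.e. the law
      at level `r` outright: this is the card's stratum (i) in its most general form (it contains every
      closest point whose residual is a sum of `≤ ⌊d⌋` triads — in particular EVERY deletion-type optimum, where
      `R` is the sum of the `d` deleted unit products, e.g. `T − e` at `(2,6)`, Bini at `(2,5)` — and every closest
      point whose deficiency profile `(m_A,m_B,m_C)` spans a sub-format of maximal border rank `≤ ⌊d⌋`, all `n`);
  (c) otherwise — `S` is CONCISE in all three modes and its residual is DEFICIENT (`⌊d⌋ < R̲(T − S)`, the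
      super-additive rungs `(2,3)`, `(2,4)`, `(3,15)`, `(3,16)`, …) — the open core `stub_conciseDeficientResidual`
      asserts the unit witness `‖T − S‖_σ ≥ 1` there, WITH the critical normal form `CriticalGram S`
      (`stub_criticalCompression`, the card's lever L1: full-group first-order optimality
      `S_(p)T_(p)^* = S_(p)S_(p)^*` in the three modes, whence `K_p := S_(p)T_(p)^*/n` Hermitian, `0 ⪯ K_p ⪯ I`,
      `R_(p)R_(p)^* = n(I − K_p)`, `d = n·tr(I − K_p)`, `R ∈ ⊗_p range(I − K_p)`) as a hypothesis; then (a)'s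
      step applies again.
* `LinearDefectLaw_of : LinearDefectLaw` — kernel-checked composition of the six stubs (no `sorry` of its own).

Disproof / Negative lane read and honoured (`Cruxes/LinearDefectLaw/Disproof.lean` cycle 1; landed
`Theorems/LinearDefectLaw/Negative/TwoByTwoRungs.lean`, imported above so every stub elaborates next to it):
`linearDefectLaw_false_without_rank` — the rank bound is consumed exactly where `law_at_of_distLaw` puts the
projection `c • S` into `secantCone n r` (`tensorRank_smul_le`) and where the induction reads `r < R̲` as
"`k + 1` more levels to climb"; `linearDefectLaw_tight_two_six` / `_tight_two_five` (`MredZ_vals`) — branch (b)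
is an EQUALITY there (`R = e`, `R̲(R) = 1 = d`; Bini residual `R̲(R) = 2 = d`) and branch (a) holds with
`|R(x,y,z)| = 1` exactly, so no stub claims slack (`linearDefectLaw_not_slack`); `linearDefectLaw_not_of_int`
(kill shape) — untouched. Self-refuted strengthenings of the card (SpectralGap at (2,3); MeanDeficiency,
ResidualRank, Grassmann completion at (2,4); PRL/NRL of the sibling card at (2,3)/(2,4), triage r1-3) are NOT
stubs: completion enters only as the CONDITIONAL branch (b). Negatives index (`ledger negatives`): 4 STPP /
design refutations, unrelated; no stub restates a refuted statement, the crux, or the summit.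
-/

noncomputable section

namespace Summit.MatrixMultiplication.MatrixMultiplication.Cruxes.LinearDefectLaw.CriticalCompressionNormalForm

open scoped BigOperators ComplexConjugate
open Literature.Computability.AlgebraicComplexity
open Summit.MatrixMultiplication.MatrixMultiplication.Theses.FidelityWitnesses (LinearDefectLaw)

set_option linter.unusedVariables false
set_option linter.dupNamespace false

/-! ## Vocabulary -/

/-- A slot of `⟨n,n,n⟩`: index pairs. The tree's `matMulTensor ℂ n n n a b c` is `1` iff
`a.1 = b.1 ∧ b.2 = c.1 ∧ a.2 = c.2`, i.e. `a = (i,j)`, `b = (i,k)`, `c = (k,j)`. -/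
abbrev P (n : ℕ) : Type := Fin n × Fin n

/-- `T = ⟨n,n,n⟩` over `ℂ`. -/
abbrev T (n : ℕ) : P n → P n → P n → ℂ := matMulTensor ℂ n n n

/-- Squared `ℓ²` (Frobenius) distance of two tensors. -/
def sqDist {n : ℕ} (A B : P n → P n → P n → ℂ) : ℝ := ∑ a, ∑ b, ∑ c, ‖A a b c - B a b c‖ ^ 2

/-- `σ̂_r`: the closure (product topology of `ℂ^{n⁶}`) of the tensors of rank `≤ r`; by Alder–Strassen
(tree, `mem_secantCone_iff` below) it is `{S | algBorderRank S ≤ r}`. -/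
def secantCone (n r : ℕ) : Set (P n → P n → P n → ℂ) := closure {S | tensorRank S ≤ r}

/-- `S` is a closest point of `σ̂_r` to `⟨n,n,n⟩` (a minimiser of the squared distance on the closed cone). -/
def IsClosestPoint (n r : ℕ) (S : P n → P n → P n → ℂ) : Prop :=
  S ∈ secantCone n r ∧ ∀ S' ∈ secantCone n r, sqDist (T n) S ≤ sqDist (T n) S'

/-- The residual `R = T − S`. -/
def resid {n : ℕ} (S : P n → P n → P n → ℂ) : P n → P n → P n → ℂ := fun a b c => T n a b c - S a b c

/-- Mode-A overlap matrix `(S_(A) T_(A)^*)_{a a'} = Σ_{b,c} S_{abc} conj T_{a'bc}` (`= n·K_A`). -/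
def overlapA {n : ℕ} (S : P n → P n → P n → ℂ) (a a' : P n) : ℂ := ∑ b, ∑ c, S a b c * conj (T n a' b c)

/-- Mode-A Gram matrix `(S_(A) S_(A)^*)_{a a'}`. -/
def gramA {n : ℕ} (S : P n → P n → P n → ℂ) (a a' : P n) : ℂ := ∑ b, ∑ c, S a b c * conj (S a' b c)

/-- Mode-B overlap matrix. -/
def overlapB {n : ℕ} (S : P n → P n → P n → ℂ) (b b' : P n) : ℂ := ∑ a, ∑ c, S a b c * conj (T n a b' c)

/-- Mode-B Gram matrix. -/
def gramB {n : ℕ} (S : P n → P n → P n → ℂ) (b b' : P n) : ℂ := ∑ a, ∑ c, S a b c * conj (S a b' c)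

/-- Mode-C overlap matrix. -/
def overlapC {n : ℕ} (S : P n → P n → P n → ℂ) (c c' : P n) : ℂ := ∑ a, ∑ b, S a b c * conj (T n a b c')

/-- Mode-C Gram matrix. -/
def gramC {n : ℕ} (S : P n → P n → P n → ℂ) (c c' : P n) : ℂ := ∑ a, ∑ b, S a b c * conj (S a b c')

/-- **The critical normal form (card L1).** `S_(p) T_(p)^* = S_(p) S_(p)^*` in the three modes, i.e.
`S_(p) R_(p)^* = 0`: the residual is Gram-orthogonal to the approximant in every mode. Consequences (tight
frames `T_(p)T_(p)^* = n·I`): `K_p := S_(p)T_(p)^*/n` is a Hermitian contraction, `R_(p)R_(p)^* = n(I − K_p)`,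
`‖T − S‖² = n·tr(I − K_p)` (same in all modes), `R ∈ ⊗_p range(I − K_p)`. -/
def CriticalGram {n : ℕ} (S : P n → P n → P n → ℂ) : Prop :=
  (∀ a a', overlapA S a a' = gramA S a a') ∧ (∀ b b', overlapB S b b' = gramB S b b') ∧
    (∀ c c', overlapC S c c' = gramC S c c')

/-- Trilinear evaluation `R(x,y,z) = Σ R_{abc} x_a y_b z_c`; its supremum over unit `x, y, z` is the spectral
(injective) norm `‖R‖_σ`. -/
def trilin {n : ℕ} (R : P n → P n → P n → ℂ) (x y z : P n → ℂ) : ℂ := ∑ a, ∑ b, ∑ c, R a b c * x a * y b * z c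

/-- Unit vector of one slot. -/
def IsUnitVec {n : ℕ} (x : P n → ℂ) : Prop := ∑ i, ‖x i‖ ^ 2 = 1

/-- **Unit witness at `S`**: `‖T − S‖_σ ≥ 1`, EXHIBITED — some unit rank-one functional sees a full unit of the
residual. (URL / SpectralResidual / RSL of the sibling cards is "every closest point `S ≠ T` has a unit
witness".) -/
def UnitWitness {n : ℕ} (S : P n → P n → P n → ℂ) : Prop :=
  ∃ x y z : P n → ℂ, IsUnitVec x ∧ IsUnitVec y ∧ IsUnitVec z ∧ 1 ≤ ‖trilin (resid S) x y z‖

/-- Mode A has an UNUSED RANK-ONE DIRECTION: some `η = u v^*` (`η_{(i,j)} = u_i conj v_j`, `u, v ≠ 0`) has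
`η^* S_(A) = 0`, i.e. `K_A η = 0`. -/
def UnusedA {n : ℕ} (S : P n → P n → P n → ℂ) : Prop :=
  ∃ u v : Fin n → ℂ, u ≠ 0 ∧ v ≠ 0 ∧ ∀ b c : P n, (∑ a : P n, conj (u a.1) * v a.2 * S a b c) = 0

/-- Mode B has an unused rank-one direction. -/
def UnusedB {n : ℕ} (S : P n → P n → P n → ℂ) : Prop :=
  ∃ u v : Fin n → ℂ, u ≠ 0 ∧ v ≠ 0 ∧ ∀ a c : P n, (∑ b : P n, conj (u b.1) * v b.2 * S a b c) = 0

/-- Mode C has an unused rank-one direction. -/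
def UnusedC {n : ℕ} (S : P n → P n → P n → ℂ) : Prop :=
  ∃ u v : Fin n → ℂ, u ≠ 0 ∧ v ≠ 0 ∧ ∀ a b : P n, (∑ c : P n, conj (u c.1) * v c.2 * S a b c) = 0

/-- Some factor has an unused rank-one direction (`S` is NOT concise in the rank-one sense in some mode). Its
negation — every `ker K_p` free of rank-one matrices — is the CONCISE regime (e.g. the closest points at
`(2,3)`, `(2,4)`, where `ker K_A` is a line spanned by a rank-two matrix). -/
def HasUnusedDirection {n : ℕ} (S : P n → P n → P n → ℂ) : Prop := UnusedA S ∨ UnusedB S ∨ UnusedC S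

/-! ## The stubs -/

/-- **Stub 1 — closest points exist.** For every `n, r` the closed cone `σ̂_r` has a point nearest to
`⟨n,n,n⟩`.
Why true (provable now): `secantCone n r` is closed and contains `0`; `sqDist (T n)` is continuous and its
sublevel set `{S | sqDist (T n) S ≤ sqDist (T n) 0}` is bounded in the sup metric (each coordinate of `T − S`
is bounded by the `ℓ²` sum, `Finset.single_le_sum`), hence compact (`ProperSpace` of the finite Pi type,
`Metric.isCompact_of_isClosed_isBounded`); minimise on the compact intersection (`IsCompact.exists_isMinOn`)
and compare with points outside the sublevel set. Size M⁻ (the tree's `exists_frobSq_minimizer`,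
KempfNessMinimizer.lean, is the same device). -/
theorem stub_closestPoint (n r : ℕ) : ∃ S : P n → P n → P n → ℂ, IsClosestPoint n r S := by
  sorry

/-- **Stub 2 — CRITICAL COMPRESSION, the card's lever L1: full-group first-order optimality.** At a closest
point `S` of `σ̂_r`, `S_(p) T_(p)^* = S_(p) S_(p)^*` in each of the three modes.
Why true (provable now; valid at BORDER closest points, no smoothness): for ANY matrix `X` on slot A the linear
map `g_t := 1 + tX` acting on mode A sends triads to triads, so `g_t · {rank ≤ r} ⊆ {rank ≤ r}`
(`tensorRank_le_of_eq_sum` on an optimal decomposition) and, being continuous (a finite sum of coordinates),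
`g_t · secantCone ⊆ secantCone`; hence `f(t) := sqDist T (g_t · S) ≥ f(0)` for all real `t`, and
`f(t) = d − 2t·Re⟨X·S, T − S⟩ + t²‖X·S‖²` forces `Re⟨X·S, T − S⟩ = 0`; with `iX` also the imaginary part,
so `Σ_{a,a'} X_{a a'} (S_(A) R_(A)^*)_{a' a} = 0` for all `X`, i.e. `S_(A) R_(A)^* = 0`, which is
`overlapA S = gramA S` entrywise (`R = T − S`). Modes B, C: the same computation on the other slots.
Consequences handed to Stub 6 (all algebra, tight frames `Σ_{b,c} T_{abc} conj T_{a'bc} = n·δ_{aa'}`):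
`K_p := overlap_p/n` Hermitian with `0 ⪯ K_p ⪯ I` (`Q_pQ_p^* = n(K_p − K_p²) ⪰ 0`), `R_(p)R_(p)^* = n(I − K_p)`,
`sqDist T S = n³ − Re tr overlapA S = n·tr(I − K_A)` (same in all modes), and the sub-format localisation L2:
every `η` with `K_A η = η` has `η^* R_(A) = 0`, so `R ∈ range(I−K_A) ⊗ range(I−K_B) ⊗ range(I−K_C)`.
Verified numerically at every optimum on file (‖S T^* − S S^*‖ ≤ 7·10⁻⁴ border / 10⁻⁹ honest, kit j010429,
j010607; triage r1-1 Part B, r1-3 T3–T6). Size L. -/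
theorem stub_criticalCompression (n r : ℕ) (S : P n → P n → P n → ℂ) (hS : IsClosestPoint n r S) :
    CriticalGram S := by
  sorry

/-- **Stub 3 — an unused rank-one direction EXHIBITS the uncovered unit product (the proved regime of L2 /
URL; holds for EVERY tensor `S`, closest or not).**
Why true (provable now, finite-sum algebra): mode A, `η = u v^*` with `η^* S_(A) = 0`. Then
`Σ_a conj(η_a) R_{abc} = Σ_a conj(η_a) T_{abc} = conj(u_{b.1}) v_{c.2} δ_{b.2,c.1}`. Take any unit
`w : Fin n → ℂ` (`Fin n` is nonempty since `u ≠ 0`) and the unit vectors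
`x_a := conj(u_{a.1}) v_{a.2}/(‖u‖‖v‖)`, `y_{(i,k)} := u_i conj(w_k)/‖u‖`, `z_{(k,j)} := w_k conj(v_j)/‖v‖`:
`trilin R x y z = Σ_{i,k,j} |u_i|²|w_k|²|v_j|²/(‖u‖²‖v‖²) = 1` EXACTLY. Mode B (`ξ = u v^*` on slot `b = (i,k)`):
`Σ_b conj(ξ_b) T_{abc} = conj(u_{a.1}) v_{c.1} δ_{a.2,c.2}`, take `y := conj ξ/‖ξ‖`, `x_{(i,j)} := u_i conj(w_j)/‖u‖`,
`z_{(k,j)} := conj(v_k) w_j/‖v‖`. Mode C (`ζ` on slot `c = (k,j)`): `Σ_c conj(ζ_c) T_{abc} = conj(u_{b.2}) v_{a.2}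
δ_{a.1,b.1}`, take `z := conj ζ/‖ζ‖`, `x_{(i,j)} := w_i conj(v_j)/‖v‖`, `y_{(i,k)} := conj(w_i) u_k/‖u‖`. In each
case the witness value is `1`: these are URL's EQUALITY cases (deletion / block optima, `(2,2)`, `(2,5)`,
`(3,5)`, `(3,6)`: `‖R‖_σ = 1.0000`). With `rank K_p ≤ r` this proves URL for `r ≤ 2n − 2` once a rank-one
element of `ker K_p` is produced (sibling stub `URL_lowRank`, not needed by this composition). Size M. -/
theorem stub_unusedDirection {n : ℕ} (S : P n → P n → P n → ℂ) (h : HasUnusedDirection S) :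
    UnitWitness S := by
  sorry

/-- **Stub 4 — one rank-one step inside the closed cones (two-plane Bessel).** From `S ∈ σ̂_r` and unit
`x, y, z`, the tensor `S' := S + R(x,y,z) · (x̄ ⊗ ȳ ⊗ z̄)` lies in `σ̂_{r+1}` and
`sqDist T S' = sqDist T S − |R(x,y,z)|²` (equality; `≤` is what the composition uses).
Why true (provable now): `S_k → S` with `tensorRank S_k ≤ r` gives `S_k + t·E → S + t·E` with rank `≤ r + 1`
(`tensorRank_add_le`, rank of a triad `≤ 1`; continuity of translation / `Filter.Tendsto.add_const`), so
`S' ∈ closure {rank ≤ r+1}`; and with `E_{abc} = conj(x_a y_b z_c)`, `Σ‖E‖² = 1`, `Σ conj(E)·R = R(x,y,z) =: t`: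
`‖R − tE‖² = ‖R‖² − 2|t|² + |t|²`. Size M. -/
theorem stub_oneStep (n r : ℕ) (S : P n → P n → P n → ℂ) (x y z : P n → ℂ) (hS : S ∈ secantCone n r)
    (hx : IsUnitVec x) (hy : IsUnitVec y) (hz : IsUnitVec z) :
    ∃ S' : P n → P n → P n → ℂ, S' ∈ secantCone n (r + 1) ∧
      sqDist (T n) S' ≤ sqDist (T n) S - ‖trilin (resid S) x y z‖ ^ 2 := by
  sorry

/-- **Stub 5 — PRIMAL COMPLETION (the card's stratum-(i) mechanism): border subadditivity over `ℂ`.** If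
`S ∈ σ̂_r` and the residual `T − S` has border rank `≤ k`, then `R̲(⟨n,n,n⟩) ≤ r + k` (`T = S + (T − S)`).
Why true (provable now): `T − S ∈ closure {rank ≤ k}` (`mem_closure_setOf_tensorRank_le_of_algBorderRank_le`),
`closure A + closure B ⊆ closure (A + B)` (continuity of addition) and `{rank ≤ r} + {rank ≤ k} ⊆ {rank ≤ r+k}`
(`tensorRank_add_le`), so `T ∈ secantCone n (r + k)`, i.e. `R̲(T) ≤ r + k` (`mem_secantCone_iff`, Alder–Strassen,
tree). (Equivalently: pad the two approximate decompositions to a common order `ε^{h+h'}`.) Sufficient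
conditions for the hypothesis `R̲(T − S) ≤ ⌊d⌋` (branch (b) of the composition) the line lead may want as lemmas:
a DELETION-TYPE residual (the sum of the `d` deleted unit products) has `R(R) ≤ d` trivially
(`tensorRank_le_of_eq_sum`); `R` supported in a sub-format `U⊗V⊗W` has
`R̲(R) ≤ R(R) ≤ min(dim U·dim V, dim V·dim W, dim U·dim W)`; pencil sub-formats `a×b×2` have maximal border rank
`min(a, 2b)` (`a ≥ b`, Kronecker; BurgisserClausenShokrollahi1997 §19 — not in tree; never needed by the
composition). Size M⁻. -/
theorem stub_primalCompletion (n r : ℕ) (S : P n → P n → P n → ℂ) (k : ℕ) (hS : S ∈ secantCone n r)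
    (hk : algBorderRank (resid S) ≤ k) : algBorderRank (T n) ≤ r + k := by
  sorry

/-- **Stub 6 — THE OPEN CORE: unit residual at CONCISE, DEFICIENT closest points, given the critical normal
form.** At a closest point `S` of `σ̂_r` whose three factors have no unused rank-one direction and whose
residual is not completable within budget (`⌊d⌋ < R̲(T − S)`; in particular `S ≠ T`), some unit rank-one
functional sees a full unit of the residual: `‖T − S‖_σ ≥ 1`.
What the hypotheses give: `CriticalGram S` ⇒ `K_p` Hermitian contractions, `R_(p)R_(p)^* = n(I − K_p)` (the
flattening spectra of `R` are `√(n(1 − κ_i))`), `d = n·tr(I − K_p)`, `R ∈ ⊗_p range(I − K_p)`; conciseness ⇒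
`ker K_p` meets the Segre cone only at `0` (so `rank K_p ≥ n² − 2n + 2`, hence `r ≥ rank S_(p) > 2n − 2`);
deficiency ⇒ `d < R̲(R)` (thin deficiencies: `(2,3)` `d = 4.994`, `R̲(R) ≥ 5`; `(2,4)` `d = 5 − √2`,
`R̲(R) ≥ 4`). Intended mechanism (card, Why (4b)): for each unit rank-one `ζ = u v^*` the `n` rotated
products `ζ ⊗ (v w_k^*) ⊗ (w_k u^*)` over an orthonormal `{w_k}` have residual overlaps AVERAGING
`1 − ⟨ζ, K_A ζ⟩`; the claim is the concentration step "max ≥ 1" for three coupled Hermitian contractions on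
their rank-one numerical ranges (the EPR-triangle structure of `⟨n,n,n⟩`). Evidence: every computed closest
point satisfies it — margins `1.004982` at `(2,3)`, `1.0618` at `(2,4)` (four independent codes incl. pure-Lean
floats, triage r1-3 T3/T4; two-sided bracket `[1.0618, 1.0740]` at `(2,4)`, r1-1 Part B), `n = 3` local optima
`r = 10, 13, 14, 15` (margins `6·10⁻²…10⁻⁴`), Smirnov-seeded window points `r = 16…19` (`‖E‖_σ ∈ [1.00004, 1.20]`,
r1-1 Part C), 21 rectangular rungs (r1-2 C). Why it might fail: it is URL on the stratum carrying all of the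
crux's analog difficulty; a certified closest point with `‖T − S‖_σ < 1` kills it (none known; HOPM gives
only lower bounds). DEAD mechanisms NOT to be used here: SpectralGap, MeanDeficiency `d ≥ max m_p`, residual /
Grassmann completion, PRL/NRL (`E_op` is not Hermitian at `(2,3)`), standard-frame deletion currency. Size XL. -/
theorem stub_conciseDeficientResidual (n r : ℕ) (S : P n → P n → P n → ℂ) (hS : IsClosestPoint n r S)
    (hcrit : CriticalGram S) (hconc : ¬ HasUnusedDirection S)
    (hdef : ⌊sqDist (T n) S⌋₊ < algBorderRank (resid S)) : UnitWitness S := by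
  sorry

/-! ## Proved glue: Alder–Strassen bridge, `‖⟨n,n,n⟩‖² = n³`, projection onto a complex line -/

theorem sqDist_nonneg {n : ℕ} (A B : P n → P n → P n → ℂ) : 0 ≤ sqDist A B := by
  unfold sqDist
  positivity

/-- Membership in `σ̂_r` is border rank `≤ r` (Alder–Strassen over `ℂ`, Euclidean form; tree theorems
`mem_closure_setOf_tensorRank_le_iff` + `alder_secantVariety_eq_setOf_algBorderRank_le_holds`). [folklore] -/
theorem mem_secantCone_iff {n r : ℕ} (S : P n → P n → P n → ℂ) :
    S ∈ secantCone n r ↔ algBorderRank S ≤ r :=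
  mem_closure_setOf_tensorRank_le_iff alder_secantVariety_eq_setOf_algBorderRank_le_holds r S

/-- The entries of `⟨n,n,n⟩` are `0/1`: their norms are the real tensor's entries. [folklore] -/
theorem norm_T (n : ℕ) (a b c : P n) : ‖T n a b c‖ = matMulTensor ℝ n n n a b c := by
  simp only [T, matMulTensor]
  split_ifs <;> simp

theorem sq_matMulTensor_real (n : ℕ) (a b c : P n) :
    matMulTensor ℝ n n n a b c ^ 2 = matMulTensor ℝ n n n a b c := by
  simp only [matMulTensor]
  split_ifs <;> simp

/-- `Σ_{abc} ⟨n,n,n⟩_{abc} = n³` (number of unit products). [folklore] -/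
theorem sum_matMulTensor_real (n : ℕ) :
    (∑ a : P n, ∑ b : P n, ∑ c : P n, matMulTensor ℝ n n n a b c) = (n : ℝ) ^ 3 := by
  have h1 : ∀ a b : P n,
      (∑ c : P n, matMulTensor ℝ n n n a b c) = if a.1 = b.1 then 1 else 0 := by
    intro a b
    by_cases hab : a.1 = b.1
    · rw [if_pos hab, Finset.sum_eq_single (b.2, a.2)]
      · simp [matMulTensor, hab]
      · intro c _ hc
        simp only [matMulTensor]
        rw [if_neg]
        rintro ⟨-, h2, h3⟩
        exact hc (Prod.ext h2.symm h3.symm)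
      · intro h
        exact absurd (Finset.mem_univ _) h
    · rw [if_neg hab]
      exact Finset.sum_eq_zero fun c _ => by
        simp [matMulTensor, hab]
  have h2 : ∀ a : P n, (∑ b : P n, if a.1 = b.1 then (1 : ℝ) else 0) = n := by
    intro a
    rw [Fintype.sum_prod_type, Finset.sum_comm]
    simp
  simp_rw [h1, h2]
  simp [Finset.sum_const, Finset.card_univ, Fintype.card_prod, Fintype.card_fin]
  ring

/-- `‖⟨n,n,n⟩‖² = n³`. [folklore] -/
theorem normSq_T (n : ℕ) : (∑ a : P n, ∑ b : P n, ∑ c : P n, ‖T n a b c‖ ^ 2) = (n : ℝ) ^ 3 := by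
  simp_rw [norm_T, sq_matMulTensor_real]
  exact sum_matMulTensor_real n

/-- `⟨n,n,n⟩` is a real tensor: conjugation fixes its entries. [folklore] -/
theorem conj_T (n : ℕ) (a b c : P n) : conj (T n a b c) = T n a b c := by
  simp only [T, matMulTensor]
  split_ifs <;> simp

/-- Sesquilinear and bilinear overlaps with the real tensor `⟨n,n,n⟩` have the same norm. [folklore] -/
theorem norm_overlap_conj {n : ℕ} (S : P n → P n → P n → ℂ) :
    ‖∑ a, ∑ b, ∑ c, conj (S a b c) * T n a b c‖ = ‖∑ a, ∑ b, ∑ c, S a b c * T n a b c‖ := by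
  have h : (∑ a, ∑ b, ∑ c, conj (S a b c) * T n a b c)
      = conj (∑ a, ∑ b, ∑ c, S a b c * T n a b c) := by
    simp only [map_sum, map_mul, conj_T]
  rw [h, Complex.norm_conj]

/-- **Projection onto a complex line (Bessel, `ℓ²` form).** For finitely indexed `x ≠ 0` and `y`, the
orthogonal projection `(z/Σ‖xᵢ‖²)·x` of `y` onto `ℂ·x` (`z = Σ conj(xᵢ) yᵢ`) is at squared distance
`Σ‖yᵢ‖² − |z|²/Σ‖xᵢ‖²` from `y`. [folklore] -/
theorem sum_norm_sq_proj_sub {α : Type*} [Fintype α] (x y : α → ℂ) (hx : 0 < ∑ i, ‖x i‖ ^ 2) :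
    (∑ i, ‖(∑ j, conj (x j) * y j) / ((∑ j, ‖x j‖ ^ 2 : ℝ) : ℂ) * x i - y i‖ ^ 2)
      = (∑ i, ‖y i‖ ^ 2) - ‖∑ j, conj (x j) * y j‖ ^ 2 / ∑ j, ‖x j‖ ^ 2 := by
  obtain ⟨s2, hs2⟩ : ∃ s2 : ℝ, (∑ i, ‖x i‖ ^ 2) = s2 := ⟨_, rfl⟩
  obtain ⟨t2, ht2⟩ : ∃ t2 : ℝ, (∑ i, ‖y i‖ ^ 2) = t2 := ⟨_, rfl⟩
  obtain ⟨z, hz⟩ : ∃ z : ℂ, (∑ i, conj (x i) * y i) = z := ⟨_, rfl⟩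
  rw [hs2] at hx
  rw [hs2, ht2, hz]
  have key : ∀ i, ‖z / (s2 : ℂ) * x i - y i‖ ^ 2
      = ‖z‖ ^ 2 / s2 ^ 2 * ‖x i‖ ^ 2 + ‖y i‖ ^ 2
          - 2 * (z / (s2 : ℂ) * (x i * conj (y i))).re := by
    intro i
    rw [Complex.sq_norm, Complex.sq_norm, Complex.sq_norm, Complex.sq_norm, Complex.normSq_sub,
      Complex.normSq_mul, Complex.normSq_div, mul_assoc]
    congr 2
    rw [Complex.normSq_ofReal]
    ring
  have hw : (∑ i, x i * conj (y i)) = conj z := by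
    rw [← hz, map_sum]
    exact Finset.sum_congr rfl fun i _ => by simp [mul_comm]
  have hre : (z / (s2 : ℂ) * conj z).re = ‖z‖ ^ 2 / s2 := by
    rw [div_mul_eq_mul_div, Complex.mul_conj', ← Complex.ofReal_pow, ← Complex.ofReal_div,
      Complex.ofReal_re]
  have hsum : (∑ i, ‖z / (s2 : ℂ) * x i - y i‖ ^ 2) = ‖z‖ ^ 2 / s2 ^ 2 * s2 + t2
      - 2 * (‖z‖ ^ 2 / s2) := by
    rw [Finset.sum_congr rfl fun i _ => key i, Finset.sum_sub_distrib, Finset.sum_add_distrib,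
      ← Finset.mul_sum, ← Finset.mul_sum, ← Complex.re_sum, ← Finset.mul_sum, hw, hre, hs2, ht2]
  rw [hsum]
  field_simp
  ring

/-- Triple-sum form of `sum_norm_sq_proj_sub` (abstract finite index types, flattened internally).
[folklore] -/
theorem sum3_norm_sq_proj_sub {α β γ : Type*} [Fintype α] [Fintype β] [Fintype γ]
    (x y : α → β → γ → ℂ) (hx : 0 < ∑ a, ∑ b, ∑ c, ‖x a b c‖ ^ 2) :
    (∑ a, ∑ b, ∑ c, ‖(∑ a', ∑ b', ∑ c', conj (x a' b' c') * y a' b' c') /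
        ((∑ a', ∑ b', ∑ c', ‖x a' b' c'‖ ^ 2 : ℝ) : ℂ) * x a b c - y a b c‖ ^ 2)
      = (∑ a, ∑ b, ∑ c, ‖y a b c‖ ^ 2) -
          ‖∑ a, ∑ b, ∑ c, conj (x a b c) * y a b c‖ ^ 2 / ∑ a, ∑ b, ∑ c, ‖x a b c‖ ^ 2 := by
  have h1 : (∑ a, ∑ b, ∑ c, ‖x a b c‖ ^ 2) = ∑ p : α × β × γ, ‖x p.1 p.2.1 p.2.2‖ ^ 2 := by
    simp only [Fintype.sum_prod_type]
  have h2 : (∑ a, ∑ b, ∑ c, conj (x a b c) * y a b c)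
      = ∑ p : α × β × γ, conj (x p.1 p.2.1 p.2.2) * y p.1 p.2.1 p.2.2 := by
    simp only [Fintype.sum_prod_type]
  have h3 : (∑ a, ∑ b, ∑ c, ‖y a b c‖ ^ 2) = ∑ p : α × β × γ, ‖y p.1 p.2.1 p.2.2‖ ^ 2 := by
    simp only [Fintype.sum_prod_type]
  have h4 : ∀ c₀ : ℂ, (∑ a, ∑ b, ∑ c, ‖c₀ * x a b c - y a b c‖ ^ 2)
      = ∑ p : α × β × γ, ‖c₀ * x p.1 p.2.1 p.2.2 - y p.1 p.2.1 p.2.2‖ ^ 2 := by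
    intro c₀
    simp only [Fintype.sum_prod_type]
  rw [h4, h1, h2, h3]
  apply sum_norm_sq_proj_sub
  rw [← h1]
  exact hx

/-- **The squared distance from `⟨n,n,n⟩` to its projection onto the line through `S ≠ 0`** is
`n³ − |Σ conj(S)·T|²/Σ‖S‖²`. [folklore] -/
theorem sqDist_proj {n : ℕ} (S : P n → P n → P n → ℂ) (hpos : 0 < ∑ a, ∑ b, ∑ c, ‖S a b c‖ ^ 2) :
    sqDist (T n)
        (((∑ a, ∑ b, ∑ c, conj (S a b c) * T n a b c) / ((∑ a, ∑ b, ∑ c, ‖S a b c‖ ^ 2 : ℝ) : ℂ)) • S)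
      = (n : ℝ) ^ 3 - ‖∑ a, ∑ b, ∑ c, conj (S a b c) * T n a b c‖ ^ 2 / (∑ a, ∑ b, ∑ c, ‖S a b c‖ ^ 2) := by
  have h4 : ∀ c₀ : ℂ, sqDist (T n) (c₀ • S) = ∑ a, ∑ b, ∑ c, ‖c₀ * S a b c - T n a b c‖ ^ 2 := by
    intro c₀
    unfold sqDist
    refine Finset.sum_congr rfl fun a _ => Finset.sum_congr rfl fun b _ =>
      Finset.sum_congr rfl fun c _ => ?_
    simp only [Pi.smul_apply, smul_eq_mul]
    rw [norm_sub_rev]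
  rw [h4, ← normSq_T n]
  exact sum3_norm_sq_proj_sub S (T n) hpos

/-- **Reduction of the crux at level `(n, r)` to the distance profile (sup over HONEST rank = `n³ − d_r`).**
If a closest point of `σ̂_r` exists and every closest point is at squared distance `≥ R̲(⟨n,n,n⟩) − r`, then
`|Σ S·T|² ≤ (n³ + r − R̲)·Σ‖S‖²` for every `S` of rank `≤ r`: project `T` onto `ℂ·S` (a point of `σ̂_r`,
`tensorRank_smul_le`). This is where the rank hypothesis of the crux is consumed
(`linearDefectLaw_false_without_rank`). [folklore] -/
theorem law_at_of_distLaw (n r : ℕ) (hex : ∃ S, IsClosestPoint n r S)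
    (hdist : ∀ S, IsClosestPoint n r S → (algBorderRank (T n) : ℝ) - r ≤ sqDist (T n) S)
    (S : P n → P n → P n → ℂ) (hS : tensorRank S ≤ r) :
    ‖∑ a, ∑ b, ∑ c, S a b c * matMulTensor ℂ n n n a b c‖ ^ 2 ≤
      ((n : ℝ) ^ 3 + (r : ℝ) - (algBorderRank (matMulTensor ℂ n n n) : ℝ)) *
        ∑ a, ∑ b, ∑ c, ‖S a b c‖ ^ 2 := by
  obtain ⟨S₀, hS₀⟩ := hex
  have hb : (algBorderRank (T n) : ℝ) - r ≤ sqDist (T n) S₀ := hdist S₀ hS₀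
  have hs2nn : 0 ≤ ∑ a, ∑ b, ∑ c, ‖S a b c‖ ^ 2 := by positivity
  rcases hs2nn.eq_or_lt with h0 | hpos
  · -- `S = 0`: both sides vanish
    have hS0 : ∀ a b c, S a b c = 0 := by
      intro a b c
      have ha := (Finset.sum_eq_zero_iff_of_nonneg (fun a _ => by positivity)).1 h0.symm a
        (Finset.mem_univ _)
      have hb' := (Finset.sum_eq_zero_iff_of_nonneg (fun b _ => by positivity)).1 ha b
        (Finset.mem_univ _)
      have hc := (Finset.sum_eq_zero_iff_of_nonneg (fun c _ => by positivity)).1 hb' c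
        (Finset.mem_univ _)
      simpa using hc
    have hov : (∑ a, ∑ b, ∑ c, S a b c * matMulTensor ℂ n n n a b c) = 0 :=
      Finset.sum_eq_zero fun a _ => Finset.sum_eq_zero fun b _ =>
        Finset.sum_eq_zero fun c _ => by simp [hS0 a b c]
    rw [hov, ← h0]
    simp
  · -- project `T` onto the line `ℂ·S`, a point of `σ̂_r`
    set c₀ : ℂ := (∑ a, ∑ b, ∑ c, conj (S a b c) * T n a b c) /
      ((∑ a, ∑ b, ∑ c, ‖S a b c‖ ^ 2 : ℝ) : ℂ) with hc₀
    have hmem : c₀ • S ∈ secantCone n r :=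
      subset_closure (show c₀ • S ∈ {S' : P n → P n → P n → ℂ | tensorRank S' ≤ r} from
        (tensorRank_smul_le c₀ S).trans hS)
    have hle : sqDist (T n) S₀ ≤ sqDist (T n) (c₀ • S) := hS₀.2 _ hmem
    have hproj := sqDist_proj S hpos
    rw [norm_overlap_conj] at hproj
    rw [hproj] at hle
    have hq : ‖∑ a, ∑ b, ∑ c, S a b c * T n a b c‖ ^ 2 / (∑ a, ∑ b, ∑ c, ‖S a b c‖ ^ 2)
        ≤ (n : ℝ) ^ 3 + r - (algBorderRank (T n) : ℝ) := by linarith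
    rw [div_le_iff₀ hpos] at hq
    exact hq

/-! ## The composition (kernel-checked, no `sorry` of its own) -/

/-- **Distance law by downward induction on the defect `k = R̲ − r`**, the three-way dichotomy at each closest
point: unused direction (Stub 3) or concise-deficient (Stub 6, fed by Stub 2) give a unit witness and one step
(Stub 4) to level `r + 1`, where a closest point exists (Stub 1) and the induction hypothesis applies;
completable residuals (Stub 5) give the level outright. -/
theorem distLaw_aux (n : ℕ) : ∀ k r : ℕ, r + k = algBorderRank (T n) →
    ∀ S : P n → P n → P n → ℂ, IsClosestPoint n r S → (k : ℝ) ≤ sqDist (T n) S := by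
  intro k
  induction k with
  | zero =>
    intro r _ S _
    simpa using sqDist_nonneg (T n) S
  | succ k ih =>
    intro r hr S hS
    -- a unit witness at `S` climbs one level and invokes the induction hypothesis
    have step : UnitWitness S → ((k : ℝ) + 1) ≤ sqDist (T n) S := by
      rintro ⟨x, y, z, hx, hy, hz, h1⟩
      obtain ⟨S', hS', hd'⟩ := stub_oneStep n r S x y z hS.1 hx hy hz
      obtain ⟨S'', hS''⟩ := stub_closestPoint n (r + 1)
      have hih : (k : ℝ) ≤ sqDist (T n) S'' := ih (r + 1) (by omega) S'' hS''
      have hmin : sqDist (T n) S'' ≤ sqDist (T n) S' := hS''.2 S' hS'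
      have hsq : (1 : ℝ) ≤ ‖trilin (resid S) x y z‖ ^ 2 := by nlinarith [h1]
      linarith
    push_cast
    by_cases hU : HasUnusedDirection S
    · exact step (stub_unusedDirection S hU)
    · by_cases hC : algBorderRank (resid S) ≤ ⌊sqDist (T n) S⌋₊
      · -- completable residual: the primal completion closes the level
        have hle := stub_primalCompletion n r S _ hS.1 hC
        have hk : k + 1 ≤ ⌊sqDist (T n) S⌋₊ := by omega
        have hreal := (Nat.le_floor_iff (sqDist_nonneg (T n) S)).1 hk
        push_cast at hreal
        exact hreal
      · -- concise and deficient: the open core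
        exact step (stub_conciseDeficientResidual n r S hS (stub_criticalCompression n r S hS) hU
          (not_le.mp hC))

/-- **The distance law at closest points**: `R̲(⟨n,n,n⟩) − r ≤ d(S)` for every closest point `S` of `σ̂_r`
(trivial for `r ≥ R̲`). -/
theorem distLaw (n r : ℕ) (S : P n → P n → P n → ℂ) (hS : IsClosestPoint n r S) :
    (algBorderRank (T n) : ℝ) - r ≤ sqDist (T n) S := by
  by_cases hrb : r ≤ algBorderRank (T n)
  · obtain ⟨k, hk⟩ : ∃ k, r + k = algBorderRank (T n) := ⟨_, Nat.add_sub_cancel' hrb⟩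
    have h := distLaw_aux n k r hk S hS
    have hcast : (algBorderRank (T n) : ℝ) = r + k := by exact_mod_cast hk.symm
    rw [hcast]
    linarith
  · have hlt : (algBorderRank (T n) : ℝ) < r := by exact_mod_cast not_le.mp hrb
    linarith [sqDist_nonneg (T n) S]

/-- **`LinearDefectLaw` from the six stubs** (line `critical-compression-normal-form`): at every level `(n, r)`
a closest point of `σ̂_r` exists (Stub 1) and lies at squared distance `≥ R̲ − r` (`distLaw`: Stubs 2–6), and
the crux is the projection of that fact onto honest rank-`≤ r` tensors (`law_at_of_distLaw`). -/
theorem LinearDefectLaw_of : LinearDefectLaw := by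
  unfold Summit.MatrixMultiplication.MatrixMultiplication.Theses.FidelityWitnesses.LinearDefectLaw
  intro n r S hS
  exact law_at_of_distLaw n r (stub_closestPoint n r) (fun S' hS' => distLaw n r S' hS') S hS

end Summit.MatrixMultiplication.MatrixMultiplication.Cruxes.LinearDefectLaw.CriticalCompressionNormalForm

end
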